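import Mathlib.Analysis.PSeries
import Mathlib.Analysis.SpecialFunctions.Pow.Deriv
import Mathlib.Analysis.Calculus.MeanValue
import HarnessLib

/-!
# Counting the products `n · m^s ≤ x`: `D_s(x) = ζ(s) x − Θ(x^{1/s})` for `s > 1`

Topic `Literature/NumberTheory/BeurlingPrimes`. Everything in this file is PROVED.

For real `s > 1` let `D_s(x) = #{(n, m) ∈ ℕ₊ × ℕ₊ : n m^s ≤ x} = ∑_{1 ≤ m ≤ x^{1/s}} ⌊x/m^s⌋`; this is
the integer-counting function `N_β(x)` (`β = 1/s`) of the Beurling system `ℙ ∪ ℙ^{1/β}` of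
Broucke–Debruyne–Révész (arXiv:2309.01567, §5 p. 14: "The integers of this system are formed by
the products `n l^{1/β}` where `n, l` represent classical integers"), for which they obtain by the
hyperbola method `N_β(x) = ζ(1/β)x + ζ(β)x^β + O(x^{β/(β+1)})`, "so the generalized integers are
indeed `β`-well-behaved and not better (as `ζ` does not vanish on the positive real line)".

We prove the two-sided bound that suffices for "`β`-well-behaved and not better", by an argument
simpler than the printed one (no hyperbola method, no value `ζ(β)`): writing `M = ⌊x^{1/s}⌋`,
`D_s(x) = x ∑_{m ≤ M} m^{−s} − ∑_{m ≤ M} {x/m^s}`, the fractional parts are `≥ 0` and `< 1`, and the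
tail `∑_{m > M} m^{−s}` lies between `(M+1)^{1−s}/(s−1)` and `M^{1−s}/(s−1)` (mean value theorem),
whence for `x ≥ 1`
`ζ(s) x − (2^{s−1}/(s−1) + 1) x^{1/s} ≤ D_s(x) ≤ ζ(s) x − (2^{1−s}/(s−1)) x^{1/s}`
(`le_powProdCount`, `powProdCount_le`). Here `zetaR s = ∑_{m ≥ 1} m^{−s}` (a real `tsum`).
Also: `card_eq_powProdCount` identifies `D_s(x)` with the cardinality of
`{(n, m) : n, m ≥ 1, n m^s ≤ x}`.

## References
* [BrouckeDebruyneRevesz2023] F. Broucke, G. Debruyne, Sz. Gy. Révész, *Some examples of well-behaved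
  Beurling number systems*, arXiv:2309.01567 (Trans. AMS 2024), §5 p. 14, Lemma 5.1 (read).
-/

noncomputable section

open Filter Finset
open scoped Topology

namespace Literature.NumberTheory.BeurlingPrimes

/-! ### The objects -/

/-- `D_s(x) = ∑_{1 ≤ m ≤ x^{1/s}} ⌊x / m^s⌋ = #{(n, m) ∈ ℕ₊² : n m^s ≤ x}`, the integer-counting
function of `ℙ ∪ ℙ^{s}`-products (BDR's `N_β`, `β = 1/s`). [cite: BrouckeDebruyneRevesz2023, §5 p. 14] -/
def powProdCount (s x : ℝ) : ℕ :=
  ∑ m ∈ Icc 1 ⌊x ^ s⁻¹⌋₊, ⌊x / (m : ℝ) ^ s⌋₊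

/-- `ζ(s)` for real `s > 1` as the real series `∑_{m ≥ 1} m^{−s}` (the `m = 0` term is `0^{−s} = 0`).
[folklore] -/
def zetaR (s : ℝ) : ℝ :=
  ∑' m : ℕ, (m : ℝ) ^ (-s)

variable {s : ℝ}

/-- Summability of `m ↦ m^{−s}` for `s > 1`. [folklore] -/
theorem summable_rpow_neg (hs : 1 < s) : Summable fun m : ℕ ↦ (m : ℝ) ^ (-s) :=
  Real.summable_nat_rpow.mpr (by linarith)

/-- `1 ≤ ζ(s)` (the term `m = 1`). [folklore] -/
theorem one_le_zetaR (hs : 1 < s) : 1 ≤ zetaR s := by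
  unfold zetaR
  have h := (summable_rpow_neg hs).sum_le_tsum (s := {1}) (fun m _ ↦ Real.rpow_nonneg (Nat.cast_nonneg m) _)
  simpa using h

/-- `0 < ζ(s)`. [folklore] -/
theorem zetaR_pos (hs : 1 < s) : 0 < zetaR s := lt_of_lt_of_le one_pos (one_le_zetaR hs)

/-! ### Mean value bounds for `m^{−s}` and the tail of `ζ(s)` -/

/-- Mean value theorem for `t ↦ t^{1−s}` on `[a, a+1]` (`a > 0`, `s > 1`):
`(s−1)(a+1)^{−s} ≤ a^{1−s} − (a+1)^{1−s} ≤ (s−1) a^{−s}`. [folklore] -/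
theorem rpow_sub_rpow_succ_bounds (hs : 1 < s) {a : ℝ} (ha : 0 < a) :
    (s - 1) * (a + 1) ^ (-s) ≤ a ^ (1 - s) - (a + 1) ^ (1 - s) ∧
      a ^ (1 - s) - (a + 1) ^ (1 - s) ≤ (s - 1) * a ^ (-s) := by
  have hderiv : ∀ t ∈ Set.Ioo a (a + 1), HasDerivAt (fun t : ℝ ↦ t ^ (1 - s)) ((1 - s) * t ^ (1 - s - 1)) t :=
    fun t ht ↦ Real.hasDerivAt_rpow_const (Or.inl (by linarith [ht.1] : t ≠ 0))
  have hcont : ContinuousOn (fun t : ℝ ↦ t ^ (1 - s)) (Set.Icc a (a + 1)) := by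
    refine ContinuousOn.rpow_const continuousOn_id fun t ht ↦ Or.inl ?_
    exact (ne_of_gt (lt_of_lt_of_le ha ht.1))
  obtain ⟨c, hc, hceq⟩ := exists_hasDerivAt_eq_slope (fun t : ℝ ↦ t ^ (1 - s))
    (fun t ↦ (1 - s) * t ^ (1 - s - 1)) (by linarith) hcont hderiv
  have hsimp : (1 - s - 1 : ℝ) = -s := by ring
  rw [hsimp, add_sub_cancel_left, div_one] at hceq
  -- `a^{1-s} − (a+1)^{1-s} = (s−1) c^{−s}` with `a < c < a+1`
  have hkey : a ^ (1 - s) - (a + 1) ^ (1 - s) = (s - 1) * c ^ (-s) := by linarith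
  have hc0 : 0 < c := lt_trans ha hc.1
  have h1 : c ^ (-s) ≤ a ^ (-s) := Real.rpow_le_rpow_of_nonpos ha hc.1.le (by linarith)
  have h2 : (a + 1) ^ (-s) ≤ c ^ (-s) := Real.rpow_le_rpow_of_nonpos hc0 hc.2.le (by linarith)
  rw [hkey]
  exact ⟨mul_le_mul_of_nonneg_left h2 (by linarith), mul_le_mul_of_nonneg_left h1 (by linarith)⟩

/-- `(m : ℝ)^{1−s} → 0` along the naturals shifted by `N` (`s > 1`). [folklore] -/
theorem tendsto_natCast_add_rpow (hs : 1 < s) (N : ℕ) :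
    Tendsto (fun n : ℕ ↦ ((n + N : ℕ) : ℝ) ^ (1 - s)) atTop (𝓝 0) := by
  have h1 : Tendsto (fun t : ℝ ↦ t ^ (-(s - 1))) atTop (𝓝 0) := tendsto_rpow_neg_atTop (by linarith)
  have h2 : Tendsto (fun n : ℕ ↦ ((n + N : ℕ) : ℝ)) atTop atTop :=
    tendsto_natCast_atTop_atTop.comp (tendsto_add_atTop_nat N)
  have h3 := h1.comp h2
  refine h3.congr fun n ↦ ?_
  simp only [Function.comp_apply]
  congr 1; ring

/-- The telescoping series `∑_n (g(n+N) − g(n+N+1)) = g(N)` for `g(m) = m^{1−s}`, `N ≥ 1`. [folklore] -/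
theorem hasSum_rpow_sub_rpow_succ (hs : 1 < s) {N : ℕ} (hN : 1 ≤ N) :
    HasSum (fun n : ℕ ↦ ((n + N : ℕ) : ℝ) ^ (1 - s) - ((n + N + 1 : ℕ) : ℝ) ^ (1 - s))
      ((N : ℝ) ^ (1 - s)) := by
  have hnonneg : ∀ n : ℕ, 0 ≤ ((n + N : ℕ) : ℝ) ^ (1 - s) - ((n + N + 1 : ℕ) : ℝ) ^ (1 - s) := by
    intro n
    have ha : (0 : ℝ) < (n + N : ℕ) := by exact_mod_cast (by omega : 0 < n + N)
    have h := (rpow_sub_rpow_succ_bounds hs ha).1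
    have h' : 0 ≤ (s - 1) * (((n + N : ℕ) : ℝ) + 1) ^ (-s) :=
      mul_nonneg (by linarith) (Real.rpow_nonneg (by linarith) _)
    push_cast at h h' ⊢
    linarith
  rw [hasSum_iff_tendsto_nat_of_nonneg hnonneg]
  have heq : ∀ n : ℕ, ∑ i ∈ range n, (((i + N : ℕ) : ℝ) ^ (1 - s) - ((i + N + 1 : ℕ) : ℝ) ^ (1 - s)) =
      (N : ℝ) ^ (1 - s) - ((n + N : ℕ) : ℝ) ^ (1 - s) := by
    intro n
    have h := Finset.sum_range_sub' (fun i : ℕ ↦ ((i + N : ℕ) : ℝ) ^ (1 - s)) n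
    simp only [zero_add] at h
    rw [← h]
    refine Finset.sum_congr rfl fun i _ ↦ ?_
    rw [Nat.add_right_comm i N 1]
  simp_rw [heq]
  have h := (tendsto_natCast_add_rpow hs N).const_sub ((N : ℝ) ^ (1 - s))
  rw [sub_zero] at h
  exact h

/-- **Tail of `ζ(s)` from below**: `(N+1)^{1−s}/(s−1) ≤ ∑_{m ≥ N+1} m^{−s}`. [folklore] -/
theorem le_tsum_tail (hs : 1 < s) (N : ℕ) :
    ((N + 1 : ℕ) : ℝ) ^ (1 - s) / (s - 1) ≤ ∑' n : ℕ, ((n + (N + 1) : ℕ) : ℝ) ^ (-s) := by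
  have hs1 : 0 < s - 1 := by linarith
  have htel := hasSum_rpow_sub_rpow_succ hs (N := N + 1) (by omega)
  have hsum : Summable fun n : ℕ ↦ ((n + (N + 1) : ℕ) : ℝ) ^ (-s) :=
    (summable_nat_add_iff (N + 1)).mpr (summable_rpow_neg hs)
  rw [div_le_iff₀ hs1, ← htel.tsum_eq, ← tsum_mul_right]
  refine Summable.tsum_le_tsum (fun n ↦ ?_) htel.summable (hsum.mul_right _)
  have ha : (0 : ℝ) < (n + (N + 1) : ℕ) := by exact_mod_cast (by omega : 0 < n + (N + 1))
  have h := (rpow_sub_rpow_succ_bounds hs ha).2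
  have e2 : ((n + (N + 1) + 1 : ℕ) : ℝ) = ((n + (N + 1) : ℕ) : ℝ) + 1 := by push_cast; ring
  rw [e2, mul_comm]
  exact h

/-- **Tail of `ζ(s)` from above**: `∑_{m ≥ N+1} m^{−s} ≤ N^{1−s}/(s−1)` for `N ≥ 1`. [folklore] -/
theorem tsum_tail_le (hs : 1 < s) {N : ℕ} (hN : 1 ≤ N) :
    ∑' n : ℕ, ((n + (N + 1) : ℕ) : ℝ) ^ (-s) ≤ (N : ℝ) ^ (1 - s) / (s - 1) := by
  have hs1 : 0 < s - 1 := by linarith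
  have htel := hasSum_rpow_sub_rpow_succ hs hN
  have hsum : Summable fun n : ℕ ↦ ((n + (N + 1) : ℕ) : ℝ) ^ (-s) :=
    (summable_nat_add_iff (N + 1)).mpr (summable_rpow_neg hs)
  rw [le_div_iff₀ hs1, ← htel.tsum_eq, ← tsum_mul_right]
  refine Summable.tsum_le_tsum (fun n ↦ ?_) (hsum.mul_right _) htel.summable
  have ha : (0 : ℝ) < (n + N : ℕ) := by exact_mod_cast (by omega : 0 < n + N)
  have h := (rpow_sub_rpow_succ_bounds hs ha).1
  have e2 : ((n + (N + 1) : ℕ) : ℝ) = ((n + N : ℕ) : ℝ) + 1 := by push_cast; ring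
  have e3 : ((n + N + 1 : ℕ) : ℝ) = ((n + N : ℕ) : ℝ) + 1 := by push_cast; ring
  rw [e2, e3, mul_comm]
  exact h

/-- `ζ(s) = ∑_{m ≤ N} m^{−s} + ∑_{m ≥ N+1} m^{−s}`. [folklore] -/
theorem zetaR_eq_sum_add_tsum (hs : 1 < s) (N : ℕ) :
    zetaR s = ∑ m ∈ range (N + 1), (m : ℝ) ^ (-s) + ∑' n : ℕ, ((n + (N + 1) : ℕ) : ℝ) ^ (-s) :=
  ((summable_rpow_neg hs).sum_add_tsum_nat_add (N + 1)).symm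

/-- `∑_{m < N+1} m^{−s} = ∑_{m ∈ [1, N]} m^{−s}` (the `m = 0` term vanishes). [folklore] -/
theorem sum_range_succ_eq_sum_Icc (hs : 1 < s) (N : ℕ) :
    ∑ m ∈ range (N + 1), (m : ℝ) ^ (-s) = ∑ m ∈ Icc 1 N, (m : ℝ) ^ (-s) := by
  rw [Finset.range_eq_Ico, Finset.sum_eq_sum_Ico_succ_bot (by omega), Nat.cast_zero,
    Real.zero_rpow (by linarith), zero_add]
  rfl

/-! ### The count `D_s(x)` -/

variable {x : ℝ}

/-- **Upper bound**: `D_s(x) ≤ ζ(s) x − (2^{1−s}/(s−1)) x^{1/s}` for `x ≥ 1` (the deficiency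
`ζ(s)x − D_s(x)` is at least `x` times the tail `∑_{m > x^{1/s}} m^{−s}`). [cite: BrouckeDebruyneRevesz2023, §5 p. 14] -/
theorem powProdCount_le (hs : 1 < s) (hx : 1 ≤ x) :
    (powProdCount s x : ℝ) ≤ zetaR s * x - 2 ^ (1 - s) / (s - 1) * x ^ s⁻¹ := by
  have hs0 : 0 < s := by linarith
  have hs1 : 0 < s - 1 := by linarith
  have hx0 : 0 < x := by linarith
  set M : ℕ := ⌊x ^ s⁻¹⌋₊ with hM
  have hxβ : 1 ≤ x ^ s⁻¹ := Real.one_le_rpow hx (inv_nonneg.mpr hs0.le)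
  have hMle : (M : ℝ) ≤ x ^ s⁻¹ := Nat.floor_le (by linarith)
  -- `D ≤ x · ∑_{m ≤ M} m^{-s}`
  have hD : (powProdCount s x : ℝ) ≤ x * ∑ m ∈ Icc 1 M, (m : ℝ) ^ (-s) := by
    unfold powProdCount
    rw [← hM, Nat.cast_sum, Finset.mul_sum]
    refine Finset.sum_le_sum fun m hm ↦ ?_
    have hm0 : (0 : ℝ) < m := by exact_mod_cast (Finset.mem_Icc.mp hm).1
    calc (⌊x / (m : ℝ) ^ s⌋₊ : ℝ) ≤ x / (m : ℝ) ^ s := Nat.floor_le (by positivity)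
      _ = x * (m : ℝ) ^ (-s) := by rw [Real.rpow_neg hm0.le, div_eq_mul_inv]
  -- the tail is at least `(M+1)^{1-s}/(s-1) ≥ 2^{1-s} x^{(1-s)/s}/(s-1)`
  have htail := le_tsum_tail hs M
  have hz := zetaR_eq_sum_add_tsum hs M
  rw [sum_range_succ_eq_sum_Icc hs] at hz
  have hM1 : ((M + 1 : ℕ) : ℝ) ≤ 2 * x ^ s⁻¹ := by push_cast; linarith
  have hM1pos : (0 : ℝ) < (M + 1 : ℕ) := by positivity
  have hpow : (2 * x ^ s⁻¹) ^ (1 - s) ≤ ((M + 1 : ℕ) : ℝ) ^ (1 - s) :=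
    Real.rpow_le_rpow_of_nonpos hM1pos hM1 (by linarith)
  have hsplit : (2 * x ^ s⁻¹) ^ (1 - s) = 2 ^ (1 - s) * (x ^ s⁻¹ * x⁻¹) := by
    rw [Real.mul_rpow (by norm_num) (by positivity), ← Real.rpow_mul hx0.le]
    congr 1
    rw [show s⁻¹ * (1 - s) = s⁻¹ + (-1) by field_simp; ring, Real.rpow_add hx0, Real.rpow_neg_one]
  -- assemble
  have hkey : 2 ^ (1 - s) / (s - 1) * x ^ s⁻¹ ≤ x * ∑' n : ℕ, ((n + (M + 1) : ℕ) : ℝ) ^ (-s) := by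
    have h1 : 2 ^ (1 - s) * (x ^ s⁻¹ * x⁻¹) / (s - 1) ≤ ∑' n : ℕ, ((n + (M + 1) : ℕ) : ℝ) ^ (-s) :=
      le_trans (div_le_div_of_nonneg_right (hsplit ▸ hpow) hs1.le) htail
    have h2 := mul_le_mul_of_nonneg_left h1 hx0.le
    calc 2 ^ (1 - s) / (s - 1) * x ^ s⁻¹ = x * (2 ^ (1 - s) * (x ^ s⁻¹ * x⁻¹) / (s - 1)) := by
          field_simp
      _ ≤ _ := h2
  calc (powProdCount s x : ℝ) ≤ x * ∑ m ∈ Icc 1 M, (m : ℝ) ^ (-s) := hD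
    _ = zetaR s * x - x * ∑' n : ℕ, ((n + (M + 1) : ℕ) : ℝ) ^ (-s) := by rw [hz]; ring
    _ ≤ zetaR s * x - 2 ^ (1 - s) / (s - 1) * x ^ s⁻¹ := by linarith

/-- **Lower bound**: `ζ(s) x − (2^{s−1}/(s−1) + 1) x^{1/s} ≤ D_s(x)` for `x ≥ 1`. [cite: BrouckeDebruyneRevesz2023, §5 p. 14] -/
theorem le_powProdCount (hs : 1 < s) (hx : 1 ≤ x) :
    zetaR s * x - (2 ^ (s - 1) / (s - 1) + 1) * x ^ s⁻¹ ≤ powProdCount s x := by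
  have hs0 : 0 < s := by linarith
  have hs1 : 0 < s - 1 := by linarith
  have hx0 : 0 < x := by linarith
  set M : ℕ := ⌊x ^ s⁻¹⌋₊ with hM
  have hxβ : 1 ≤ x ^ s⁻¹ := Real.one_le_rpow hx (inv_nonneg.mpr hs0.le)
  have hxβ0 : 0 < x ^ s⁻¹ := by linarith
  have hMle : (M : ℝ) ≤ x ^ s⁻¹ := Nat.floor_le (by linarith)
  have hM1 : 1 ≤ M := Nat.le_floor (by simpa using hxβ)
  have hMpos : (0 : ℝ) < M := by exact_mod_cast hM1
  -- `M ≥ x^{1/s} / 2`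
  have hMge : x ^ s⁻¹ / 2 ≤ M := by
    have h1 : x ^ s⁻¹ - 1 < M := by rw [hM]; exact Nat.sub_one_lt_floor _
    have h2 : (1 : ℝ) ≤ M := by exact_mod_cast hM1
    by_cases h : x ^ s⁻¹ ≤ 2
    · linarith
    · push Not at h; linarith
  -- `D ≥ x · ∑_{m ≤ M} m^{-s} − M`
  have hD : x * ∑ m ∈ Icc 1 M, (m : ℝ) ^ (-s) - M ≤ powProdCount s x := by
    unfold powProdCount
    rw [← hM, Nat.cast_sum, Finset.mul_sum]
    have hcard : (M : ℝ) = ∑ m ∈ Icc 1 M, (1 : ℝ) := by simp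
    rw [hcard, ← Finset.sum_sub_distrib]
    refine Finset.sum_le_sum fun m hm ↦ ?_
    have hm0 : (0 : ℝ) < m := by exact_mod_cast (Finset.mem_Icc.mp hm).1
    have h1 : x / (m : ℝ) ^ s < ⌊x / (m : ℝ) ^ s⌋₊ + 1 := Nat.lt_floor_add_one _
    rw [Real.rpow_neg hm0.le, ← div_eq_mul_inv]
    linarith
  -- the tail is at most `M^{1-s}/(s-1) ≤ 2^{s-1} x^{(1-s)/s}/(s-1)`
  have htail := tsum_tail_le hs hM1
  have hz := zetaR_eq_sum_add_tsum hs M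
  rw [sum_range_succ_eq_sum_Icc hs] at hz
  have hpow : (M : ℝ) ^ (1 - s) ≤ (x ^ s⁻¹ / 2) ^ (1 - s) :=
    Real.rpow_le_rpow_of_nonpos (by positivity) hMge (by linarith)
  have hsplit : (x ^ s⁻¹ / 2) ^ (1 - s) = 2 ^ (s - 1) * (x ^ s⁻¹ * x⁻¹) := by
    rw [Real.div_rpow (by positivity) (by norm_num), ← Real.rpow_mul hx0.le]
    rw [show s⁻¹ * (1 - s) = s⁻¹ + (-1) by field_simp; ring, Real.rpow_add hx0, Real.rpow_neg_one,
      show (1 - s : ℝ) = -(s - 1) by ring, Real.rpow_neg (by norm_num), div_eq_mul_inv, inv_inv, mul_comm]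
  have hkey : x * ∑' n : ℕ, ((n + (M + 1) : ℕ) : ℝ) ^ (-s) ≤ 2 ^ (s - 1) / (s - 1) * x ^ s⁻¹ := by
    have h1 : ∑' n : ℕ, ((n + (M + 1) : ℕ) : ℝ) ^ (-s) ≤ 2 ^ (s - 1) * (x ^ s⁻¹ * x⁻¹) / (s - 1) :=
      le_trans htail (div_le_div_of_nonneg_right (hsplit ▸ hpow) hs1.le)
    have h2 := mul_le_mul_of_nonneg_left h1 hx0.le
    calc _ ≤ x * (2 ^ (s - 1) * (x ^ s⁻¹ * x⁻¹) / (s - 1)) := h2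
      _ = 2 ^ (s - 1) / (s - 1) * x ^ s⁻¹ := by field_simp
  calc zetaR s * x - (2 ^ (s - 1) / (s - 1) + 1) * x ^ s⁻¹
      ≤ zetaR s * x - x * ∑' n : ℕ, ((n + (M + 1) : ℕ) : ℝ) ^ (-s) - M := by nlinarith
    _ = x * ∑ m ∈ Icc 1 M, (m : ℝ) ^ (-s) - M := by rw [hz]; ring
    _ ≤ powProdCount s x := hD

/-- **`D_s(x) = ζ(s)x + O(x^{1/s})`**: `|D_s(x) − ζ(s) x| ≤ (2^{s−1}/(s−1) + 1) x^{1/s}` for `x ≥ 1`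
(BDR: the integers of `ℙ ∪ ℙ^{1/β}` are `β`-well-behaved). [cite: BrouckeDebruyneRevesz2023, §5 p. 14] -/
theorem abs_powProdCount_sub_le (hs : 1 < s) (hx : 1 ≤ x) :
    |(powProdCount s x : ℝ) - zetaR s * x| ≤ (2 ^ (s - 1) / (s - 1) + 1) * x ^ s⁻¹ := by
  have h1 := powProdCount_le hs hx
  have h2 := le_powProdCount hs hx
  have h3 : 0 ≤ 2 ^ (1 - s) / (s - 1) * x ^ s⁻¹ :=
    mul_nonneg (div_nonneg (Real.rpow_nonneg (by norm_num) _) (by linarith)) (Real.rpow_nonneg (by linarith) _)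
  rw [abs_le]
  constructor <;> linarith

/-- **… and not better**: `ζ(s) x − D_s(x) ≥ (2^{1−s}/(s−1)) x^{1/s}` for `x ≥ 1`, so the error term is
not `O(x^{1/s − ε})` for any `ε > 0` (BDR: "and not better"). [cite: BrouckeDebruyneRevesz2023, §5 p. 14] -/
theorem le_zetaR_mul_sub_powProdCount (hs : 1 < s) (hx : 1 ≤ x) :
    2 ^ (1 - s) / (s - 1) * x ^ s⁻¹ ≤ zetaR s * x - powProdCount s x := by
  linarith [powProdCount_le hs hx]

/-! ### `D_s(x)` as a cardinality -/

/-- **`D_s(x) = #{(n, m) : n, m ≥ 1, n · m^s ≤ x}`** for `s > 0`, `x ≥ 0`. [cite: BrouckeDebruyneRevesz2023, §5 p. 14] -/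
theorem card_eq_powProdCount (hs : 0 < s) (hx : 0 ≤ x) :
    Nat.card {nm : ℕ × ℕ // nm.1 ≠ 0 ∧ nm.2 ≠ 0 ∧ (nm.1 : ℝ) * (nm.2 : ℝ) ^ s ≤ x} = powProdCount s x := by
  set T : Finset (Σ _ : ℕ, ℕ) := (Icc 1 ⌊x ^ s⁻¹⌋₊).sigma fun m ↦ Icc 1 ⌊x / (m : ℝ) ^ s⌋₊ with hT
  -- membership in `T`
  have hmem : ∀ n m : ℕ, (⟨m, n⟩ : Σ _ : ℕ, ℕ) ∈ T ↔ (n ≠ 0 ∧ m ≠ 0 ∧ (n : ℝ) * (m : ℝ) ^ s ≤ x) := by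
    intro n m
    rw [hT, Finset.mem_sigma, Finset.mem_Icc, Finset.mem_Icc, Nat.one_le_iff_ne_zero,
      Nat.one_le_iff_ne_zero]
    constructor
    · rintro ⟨⟨hm0, -⟩, hn0, hn⟩
      have hms : (0 : ℝ) < (m : ℝ) ^ s := Real.rpow_pos_of_pos (by exact_mod_cast Nat.pos_of_ne_zero hm0) _
      refine ⟨hn0, hm0, ?_⟩
      have h1 : (n : ℝ) ≤ x / (m : ℝ) ^ s := le_trans (by exact_mod_cast hn) (Nat.floor_le (by positivity))
      rwa [le_div_iff₀ hms] at h1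
    · rintro ⟨hn0, hm0, h⟩
      have hm0' : (0 : ℝ) < m := by exact_mod_cast Nat.pos_of_ne_zero hm0
      have hms : (0 : ℝ) < (m : ℝ) ^ s := Real.rpow_pos_of_pos hm0' _
      have hn1 : (1 : ℝ) ≤ n := by exact_mod_cast Nat.one_le_iff_ne_zero.mpr hn0
      have hmsx : (m : ℝ) ^ s ≤ x := le_trans (by nlinarith) h
      refine ⟨⟨hm0, Nat.le_floor ?_⟩, hn0, Nat.le_floor ?_⟩
      · exact (Real.le_rpow_inv_iff_of_pos hm0'.le hx hs).mpr hmsx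
      · rwa [le_div_iff₀ hms]
  have e : {nm : ℕ × ℕ // nm.1 ≠ 0 ∧ nm.2 ≠ 0 ∧ (nm.1 : ℝ) * (nm.2 : ℝ) ^ s ≤ x} ≃ {σ : (Σ _ : ℕ, ℕ) // σ ∈ T} :=
    { toFun := fun p ↦ ⟨⟨p.1.2, p.1.1⟩, (hmem p.1.1 p.1.2).mpr p.2⟩
      invFun := fun q ↦ ⟨(q.1.2, q.1.1), (hmem q.1.2 q.1.1).mp (by obtain ⟨⟨m, n⟩, hq⟩ := q; exact hq)⟩
      left_inv := fun p ↦ by rfl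
      right_inv := fun q ↦ by rfl }
  rw [Nat.card_congr e, Nat.card_eq_finsetCard, hT, Finset.card_sigma]
  unfold powProdCount
  refine Finset.sum_congr rfl fun m _ ↦ ?_
  rw [Nat.card_Icc]
  omega

end Literature.NumberTheory.BeurlingPrimes
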